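import Summits.QuantumFields.BalabanUV.Beta.GAN24.FaceReadCrossedValueZeroClosed
import Summits.QuantumFields.BalabanUV.Beta.GAN24.ForcingTableRootLetters

/-!
# `BalabanUV.Beta.GAN24.FaceReadCrossedValueRoot` — binder row G-an2-4 ∕ (CONV-C), W-slot (α-0), ROW (C) AT LEVELS `≥ 1` (the OWNER's two-index tower, RULING
# R-gan24p1-g40-1; typer's PART VI row T6-VAL, the OWNER's (R-a) at level 0): **ROAD-P2's ADAPTER, VALUE SIDE, LEVEL 0 — leaf-06 g57's (Q)
# `FaceReadCrossedValueZero.crossed_faceRead_dressedStep_zero` and (R) `FaceReadCrossedValueZeroClosed.crossed_faceRead_dressedStep_zero_closedE0` AT ROAD-P2's ACTUAL ROOT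
# TABLES** — multiplier table `M := unitM sf sm (M1At d Lc ρ_c cΛ 0)`, mixed table `M₂ := unitM₂ sf sm (M2Of d Lc (mixFFAt ρ_c Lc) 0)` (`ρ_c = toSite r`, `r ∈ box`), every side
# condition (`hM hMt hSrow hMrow hM₂ hM₂t`) discharged by `ForcingTableRootLetters`; generic `d`, any `sf sm`, any coarse period `P ≥ 1`, any `B` with zero `inl–inl` block
# (road-P2 chair `b2b-balaban-gan24-p2`, gen 51; journal [GAN24P2-G51-INTENT4])

NOT IN PRINT; OUR BOOKKEEPING ([folklore] instantiation BY NAME, two `exact`s; 0 `def`, 0 cited fact, 0 `def … : Prop`, 0 sorry; the displayed statements are (Q)'s ∕ (R)'s with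
the two tables substituted — leaf-06 g57's theorems and credit).  HONEST FRAMING (cell contract, verbatim): «discharging `BetaPertH` makes Bałaban's UV stability UNCONDITIONAL — a real
constructive-QFT result; it is NOT the continuum limit and NOT the Clay problem.»  HONEST DEPENDENCY (verbatim): «continuum YM on T⁴ ⇐ BetaPertH ∧ nine spine estimates (0/9 proved);
BetaPertH ⇐ (D1) ∧ (D4) ∧ CAP+tail; G-an2-4 gates asym, D1 and NE2/3/4.»

WHAT.  For road-P2's literal LEVEL-0 E-frame forcing `b̃_0 = c•mmRead Lc (K3OfK X̃♮_0 Lc S̃_0 M̃_0 (W2SymOfK X̃♮_0 Lc S̃_0 M̃_0 0 M̃₂_0)) + cB•B` (all three first tables at the root;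
`c cB B` generic) and a crossed pattern `a₀ ≠ b₀`:
* **`crossed_faceRead_root_zero`** — the `LS`-symmetrised coarse-period-`P` face read at `(a₀,b₀;a₀,b₀)` (the crossed value `X(FFsym_P b̃_0)(a₀,b₀)` of leaf-03's ledger, in
  leaf-02 50c's eight-sum spelling) `= 4·(c·(−K₀²))·K₀²·(Val(b₀,a₀;a₀,b₀) + Val(a₀,b₀;b₀,a₀))`, `K₀ = sf·sm·(stepScale d Lc 0·Lc^{d+1})⁻¹`, `Val` = leaf-06's E-sector value
  (the `E2 d Lc 0` cell pairing at the deep period `Lc·P` minus `Lc^{2(d+1)}`× the `E2 d Lc 1` cell pairing at period `P`) — (Q) VERBATIM at the root tables;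
* **`crossed_faceRead_root_zero_closedE0`** — the same with both level-0 Wilson-Hessian pairings EVALUATED (leaf-06's `WilsonProfilePairing`): `= W(P) − G₁(P)`, `W(P)` explicit,
  `G₁(P)` the two `E2 d Lc 1` pairings SYMBOLIC — (R) VERBATIM at the root tables = leaf-03 g72∕g73's `hface0 : Xf 0 m = W m − G 1 m` left side for road-P2's literal
  (their W-leaf03-g73-2: LEFT side token for token modulo β; RIGHT side up to the `K₀⁴` ∕ `c(k)` normalisation they check).
READING (zero weight until every link is ✓): this is the level-0 face line of the crossed VALUE ledger `hXu` for the ACTUAL tower letters; levels ≥ 1 (leaf-06 g56 `FaceWordEEValueDeep`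
∕ g57 (N) + a deep (Q)) and the telescoping (K7-W, leaf-03 (B4)∕(B5)) are the suppliers'.  Asserts NO value of Bałaban's tables beyond the displayed identities; discharges NOTHING of
`hX` ∕ `hXu` ∕ (C)_{≥1} ∕ (Q-L) ∕ (H1♮) ∕ (hW, hWall); NEVER «G-an2-4 closed» as (CONV-C); NOT D1, NOT `BetaPertH`, NOT continuum, NOT Clay.  2026-08-24; no existing file touched.
-/

noncomputable section

open Finset
open scoped BigOperators
open Literature.MathematicalPhysics.QuantumFieldTheory
open Literature.MathematicalPhysics.QuantumFieldTheory.Balaban1983to89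
open Literature.MathematicalPhysics.QuantumFieldTheory.Balaban1983to89.Beta
open ExpKernelCalculus (Site MKer shiftK VertexFamily)
open OneStepResolventKernel (Fib)
open OneStepKernelFamily (KInvStep)
open SecondOrderResponse (W2SymOfK LocStencilFM)
open BalabanStepW2 (K3OfK M2Of)
open BalabanStepJetsSucc (mmRead E2 wVH)
open AffineAveraging (box toSite)
open AveragingMixedJetTables (mixFFAt)
open Summit.QuantumFields.BalabanUV.Beta.TameKernelCalculus (trK)
open Summit.QuantumFields.BalabanUV.Beta.BorderedHessian (stepScale sgnK)
open Summit.QuantumFields.BalabanUV.Beta.AxialDressingRooted (coDressKBmAt)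
open Summit.QuantumFields.BalabanUV.Beta.HessKerDressedUnits (unitK unitS)
open Summit.QuantumFields.BalabanUV.Beta.SecondOrderUnits (unitM unitM₂)
open Summit.QuantumFields.BalabanUV.Beta.SpineRooted (SpureRecAt M1At)
open Summit.QuantumFields.BalabanUV.Beta.GAN24.BiStencilZeroMode (Tab)
open Summit.QuantumFields.BalabanUV.Beta.GAN24.ForcingTableRootLetters (trK_unitS_SpureRecAt vertexFamily_unitM_M1At unitM_M1At_translate trK_unitM_M1At
  exists_locStencilFM_unitM₂_M2Of unitM₂_M2Of_translate)
open Summit.QuantumFields.BalabanUV.Beta.GAN24.FaceReadCrossedValueZero (crossed_faceRead_dressedStep_zero)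
open Summit.QuantumFields.BalabanUV.Beta.GAN24.FaceReadCrossedValueZeroClosed (crossed_faceRead_dressedStep_zero_closedE0)

namespace Summit.QuantumFields.BalabanUV.Beta.GAN24.FaceReadCrossedValueRoot

variable {d : ℕ} {Lc : ℕ} [NeZero Lc] {r : Fin (d + 1) → ℕ}

/-- NOT IN PRINT; OUR BOOKKEEPING.  **(Q) AT THE ROOT TABLES** (module docstring): leaf-06 g57's `crossed_faceRead_dressedStep_zero` with `M := M̃_0`, `M₂ := M̃₂_0` and the six side
conditions discharged by `ForcingTableRootLetters`. -/
theorem crossed_faceRead_root_zero (hLc : 1 ≤ Lc) (hr : r ∈ box (d + 1) Lc) {P : ℕ} (hP : 1 ≤ P) (sf sm cE cVH cΛ : ℝ)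
    {B : Tab d} (hBff : ∀ κ u κ' u' x z (α β : Fin (d + 1)), B κ u κ' u' x z (Sum.inl α) (Sum.inl β) = 0) (c cB : ℝ)
    {a₀ b₀ : Fin (d + 1)} (hab : a₀ ≠ b₀) :
        ((fun μ ν α β : Fin (d + 1) => ∑ r' ∈ box (d + 1) P, ∑' u' : Site (d + 1), ∑' x : Site (d + 1), ∑' z : Site (d + 1),
            (if toSite r' μ % (P : ℤ) = (P : ℤ) - 1 ∧ u' ν % (P : ℤ) = (P : ℤ) - 1 ∧ x α % (P : ℤ) = (P : ℤ) - 1 ∧ z β % (P : ℤ) = (P : ℤ) - 1 then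
              (c • mmRead Lc (K3OfK (unitK sf sm (coDressKBmAt (toSite r) Lc (KInvStep (d := d) Lc 0))) Lc (unitS sf sm (SpureRecAt d Lc (toSite r) cE cVH cΛ 0)) (unitM sf sm (M1At d Lc (toSite r) cΛ 0))
                  (W2SymOfK (unitK sf sm (coDressKBmAt (toSite r) Lc (KInvStep (d := d) Lc 0))) Lc (unitS sf sm (SpureRecAt d Lc (toSite r) cE cVH cΛ 0)) (unitM sf sm (M1At d Lc (toSite r) cΛ 0)) 0 (unitM₂ sf sm (M2Of d Lc (mixFFAt (toSite r) Lc) 0))) μ (toSite r') ν u')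
                + cB • B μ (toSite r') ν u') x z (Sum.inl α) (Sum.inl β) else 0)) a₀ b₀ a₀ b₀
          + (fun μ ν α β : Fin (d + 1) => ∑ r' ∈ box (d + 1) P, ∑' u' : Site (d + 1), ∑' x : Site (d + 1), ∑' z : Site (d + 1),
            (if toSite r' μ % (P : ℤ) = (P : ℤ) - 1 ∧ u' ν % (P : ℤ) = (P : ℤ) - 1 ∧ x α % (P : ℤ) = (P : ℤ) - 1 ∧ z β % (P : ℤ) = (P : ℤ) - 1 then
              (c • mmRead Lc (K3OfK (unitK sf sm (coDressKBmAt (toSite r) Lc (KInvStep (d := d) Lc 0))) Lc (unitS sf sm (SpureRecAt d Lc (toSite r) cE cVH cΛ 0)) (unitM sf sm (M1At d Lc (toSite r) cΛ 0))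
                  (W2SymOfK (unitK sf sm (coDressKBmAt (toSite r) Lc (KInvStep (d := d) Lc 0))) Lc (unitS sf sm (SpureRecAt d Lc (toSite r) cE cVH cΛ 0)) (unitM sf sm (M1At d Lc (toSite r) cΛ 0)) 0 (unitM₂ sf sm (M2Of d Lc (mixFFAt (toSite r) Lc) 0))) μ (toSite r') ν u')
                + cB • B μ (toSite r') ν u') x z (Sum.inl α) (Sum.inl β) else 0)) b₀ a₀ a₀ b₀)
        + ((fun μ ν α β : Fin (d + 1) => ∑ r' ∈ box (d + 1) P, ∑' u' : Site (d + 1), ∑' x : Site (d + 1), ∑' z : Site (d + 1),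
            (if toSite r' μ % (P : ℤ) = (P : ℤ) - 1 ∧ u' ν % (P : ℤ) = (P : ℤ) - 1 ∧ x α % (P : ℤ) = (P : ℤ) - 1 ∧ z β % (P : ℤ) = (P : ℤ) - 1 then
              (c • mmRead Lc (K3OfK (unitK sf sm (coDressKBmAt (toSite r) Lc (KInvStep (d := d) Lc 0))) Lc (unitS sf sm (SpureRecAt d Lc (toSite r) cE cVH cΛ 0)) (unitM sf sm (M1At d Lc (toSite r) cΛ 0))
                  (W2SymOfK (unitK sf sm (coDressKBmAt (toSite r) Lc (KInvStep (d := d) Lc 0))) Lc (unitS sf sm (SpureRecAt d Lc (toSite r) cE cVH cΛ 0)) (unitM sf sm (M1At d Lc (toSite r) cΛ 0)) 0 (unitM₂ sf sm (M2Of d Lc (mixFFAt (toSite r) Lc) 0))) μ (toSite r') ν u')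
                + cB • B μ (toSite r') ν u') x z (Sum.inl α) (Sum.inl β) else 0)) b₀ a₀ a₀ b₀
          + (fun μ ν α β : Fin (d + 1) => ∑ r' ∈ box (d + 1) P, ∑' u' : Site (d + 1), ∑' x : Site (d + 1), ∑' z : Site (d + 1),
            (if toSite r' μ % (P : ℤ) = (P : ℤ) - 1 ∧ u' ν % (P : ℤ) = (P : ℤ) - 1 ∧ x α % (P : ℤ) = (P : ℤ) - 1 ∧ z β % (P : ℤ) = (P : ℤ) - 1 then
              (c • mmRead Lc (K3OfK (unitK sf sm (coDressKBmAt (toSite r) Lc (KInvStep (d := d) Lc 0))) Lc (unitS sf sm (SpureRecAt d Lc (toSite r) cE cVH cΛ 0)) (unitM sf sm (M1At d Lc (toSite r) cΛ 0))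
                  (W2SymOfK (unitK sf sm (coDressKBmAt (toSite r) Lc (KInvStep (d := d) Lc 0))) Lc (unitS sf sm (SpureRecAt d Lc (toSite r) cE cVH cΛ 0)) (unitM sf sm (M1At d Lc (toSite r) cΛ 0)) 0 (unitM₂ sf sm (M2Of d Lc (mixFFAt (toSite r) Lc) 0))) μ (toSite r') ν u')
                + cB • B μ (toSite r') ν u') x z (Sum.inl α) (Sum.inl β) else 0)) a₀ b₀ a₀ b₀)
        + (((fun μ ν α β : Fin (d + 1) => ∑ r' ∈ box (d + 1) P, ∑' u' : Site (d + 1), ∑' x : Site (d + 1), ∑' z : Site (d + 1),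
            (if toSite r' μ % (P : ℤ) = (P : ℤ) - 1 ∧ u' ν % (P : ℤ) = (P : ℤ) - 1 ∧ x α % (P : ℤ) = (P : ℤ) - 1 ∧ z β % (P : ℤ) = (P : ℤ) - 1 then
              (c • mmRead Lc (K3OfK (unitK sf sm (coDressKBmAt (toSite r) Lc (KInvStep (d := d) Lc 0))) Lc (unitS sf sm (SpureRecAt d Lc (toSite r) cE cVH cΛ 0)) (unitM sf sm (M1At d Lc (toSite r) cΛ 0))
                  (W2SymOfK (unitK sf sm (coDressKBmAt (toSite r) Lc (KInvStep (d := d) Lc 0))) Lc (unitS sf sm (SpureRecAt d Lc (toSite r) cE cVH cΛ 0)) (unitM sf sm (M1At d Lc (toSite r) cΛ 0)) 0 (unitM₂ sf sm (M2Of d Lc (mixFFAt (toSite r) Lc) 0))) μ (toSite r') ν u')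
                + cB • B μ (toSite r') ν u') x z (Sum.inl α) (Sum.inl β) else 0)) a₀ b₀ b₀ a₀
          + (fun μ ν α β : Fin (d + 1) => ∑ r' ∈ box (d + 1) P, ∑' u' : Site (d + 1), ∑' x : Site (d + 1), ∑' z : Site (d + 1),
            (if toSite r' μ % (P : ℤ) = (P : ℤ) - 1 ∧ u' ν % (P : ℤ) = (P : ℤ) - 1 ∧ x α % (P : ℤ) = (P : ℤ) - 1 ∧ z β % (P : ℤ) = (P : ℤ) - 1 then
              (c • mmRead Lc (K3OfK (unitK sf sm (coDressKBmAt (toSite r) Lc (KInvStep (d := d) Lc 0))) Lc (unitS sf sm (SpureRecAt d Lc (toSite r) cE cVH cΛ 0)) (unitM sf sm (M1At d Lc (toSite r) cΛ 0))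
                  (W2SymOfK (unitK sf sm (coDressKBmAt (toSite r) Lc (KInvStep (d := d) Lc 0))) Lc (unitS sf sm (SpureRecAt d Lc (toSite r) cE cVH cΛ 0)) (unitM sf sm (M1At d Lc (toSite r) cΛ 0)) 0 (unitM₂ sf sm (M2Of d Lc (mixFFAt (toSite r) Lc) 0))) μ (toSite r') ν u')
                + cB • B μ (toSite r') ν u') x z (Sum.inl α) (Sum.inl β) else 0)) b₀ a₀ b₀ a₀)
        + ((fun μ ν α β : Fin (d + 1) => ∑ r' ∈ box (d + 1) P, ∑' u' : Site (d + 1), ∑' x : Site (d + 1), ∑' z : Site (d + 1),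
            (if toSite r' μ % (P : ℤ) = (P : ℤ) - 1 ∧ u' ν % (P : ℤ) = (P : ℤ) - 1 ∧ x α % (P : ℤ) = (P : ℤ) - 1 ∧ z β % (P : ℤ) = (P : ℤ) - 1 then
              (c • mmRead Lc (K3OfK (unitK sf sm (coDressKBmAt (toSite r) Lc (KInvStep (d := d) Lc 0))) Lc (unitS sf sm (SpureRecAt d Lc (toSite r) cE cVH cΛ 0)) (unitM sf sm (M1At d Lc (toSite r) cΛ 0))
                  (W2SymOfK (unitK sf sm (coDressKBmAt (toSite r) Lc (KInvStep (d := d) Lc 0))) Lc (unitS sf sm (SpureRecAt d Lc (toSite r) cE cVH cΛ 0)) (unitM sf sm (M1At d Lc (toSite r) cΛ 0)) 0 (unitM₂ sf sm (M2Of d Lc (mixFFAt (toSite r) Lc) 0))) μ (toSite r') ν u')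
                + cB • B μ (toSite r') ν u') x z (Sum.inl α) (Sum.inl β) else 0)) b₀ a₀ b₀ a₀
          + (fun μ ν α β : Fin (d + 1) => ∑ r' ∈ box (d + 1) P, ∑' u' : Site (d + 1), ∑' x : Site (d + 1), ∑' z : Site (d + 1),
            (if toSite r' μ % (P : ℤ) = (P : ℤ) - 1 ∧ u' ν % (P : ℤ) = (P : ℤ) - 1 ∧ x α % (P : ℤ) = (P : ℤ) - 1 ∧ z β % (P : ℤ) = (P : ℤ) - 1 then
              (c • mmRead Lc (K3OfK (unitK sf sm (coDressKBmAt (toSite r) Lc (KInvStep (d := d) Lc 0))) Lc (unitS sf sm (SpureRecAt d Lc (toSite r) cE cVH cΛ 0)) (unitM sf sm (M1At d Lc (toSite r) cΛ 0))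
                  (W2SymOfK (unitK sf sm (coDressKBmAt (toSite r) Lc (KInvStep (d := d) Lc 0))) Lc (unitS sf sm (SpureRecAt d Lc (toSite r) cE cVH cΛ 0)) (unitM sf sm (M1At d Lc (toSite r) cΛ 0)) 0 (unitM₂ sf sm (M2Of d Lc (mixFFAt (toSite r) Lc) 0))) μ (toSite r') ν u')
                + cB • B μ (toSite r') ν u') x z (Sum.inl α) (Sum.inl β) else 0)) a₀ b₀ b₀ a₀))
          = 4 * ((c * -(((sf * sm) * (stepScale d Lc 0 * (Lc : ℝ) ^ (d + 1))⁻¹) * ((sf * sm) * (stepScale d Lc 0 * (Lc : ℝ) ^ (d + 1))⁻¹))) * (((sf * sm) * (stepScale d Lc 0 * (Lc : ℝ) ^ (d + 1))⁻¹) * ((sf * sm) * (stepScale d Lc 0 * (Lc : ℝ) ^ (d + 1))⁻¹))) *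
            ((((sf * sm)⁻¹ * (sf⁻¹ * sf⁻¹) * cE) * ((sf * sm)⁻¹ * (sf⁻¹ * sf⁻¹) * cE)) *
      ((-(1 / 2 : ℝ)) * (1 / 2 : ℝ) * ((sf * sf) *
        ((wVH d Lc 0)⁻¹ *
            ∑ x ∈ box (d + 1) (Lc * P), ∑ b : Fin (d + 1),
              ((if b = b₀ then ((((Lc * P : ℕ) : ℝ))⁻¹ * (((Lc * P : ℕ) : ℝ))⁻¹) * ((((toSite x a₀ % ((Lc * P : ℕ) : ℤ) : ℤ) : ℝ) - ((((Lc * P : ℕ) : ℝ)) - 1) / 2)) else 0)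
                + (if b = a₀ then (-(((Lc * P : ℕ) : ℝ))⁻¹ * ((((toSite x b₀ % ((Lc * P : ℕ) : ℤ) : ℤ) : ℝ) - ((((Lc * P : ℕ) : ℝ)) - 1) / 2))) *
                    (if toSite x a₀ % ((Lc * P : ℕ) : ℤ) = ((Lc * P : ℕ) : ℤ) - 1 then (1 : ℝ) else 0) else 0)) *
              ∑' s : Site (d + 1), ∑ b' : Fin (d + 1), E2 d Lc 0 (toSite x) s (Sum.inl b) (Sum.inl b') *
                ((if b' = a₀ then ((((Lc * P : ℕ) : ℝ))⁻¹ * (((Lc * P : ℕ) : ℝ))⁻¹) * ((((s b₀ % ((Lc * P : ℕ) : ℤ) : ℤ) : ℝ) - ((((Lc * P : ℕ) : ℝ)) - 1) / 2)) else 0)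
                  + (if b' = b₀ then (-(((Lc * P : ℕ) : ℝ))⁻¹ * ((((s a₀ % ((Lc * P : ℕ) : ℤ) : ℤ) : ℝ) - ((((Lc * P : ℕ) : ℝ)) - 1) / 2))) *
                      (if s b₀ % ((Lc * P : ℕ) : ℤ) = ((Lc * P : ℕ) : ℤ) - 1 then (1 : ℝ) else 0) else 0)) -
          (wVH d Lc 0)⁻¹ * (((Lc : ℝ) ^ (d + 1) * (Lc : ℝ) ^ (d + 1)) *
            ∑ y ∈ box (d + 1) P, ∑ a : Fin (d + 1),
              ((if a = b₀ then (((P : ℝ))⁻¹ * ((P : ℝ))⁻¹) * ((((toSite y a₀ % (P : ℤ)) : ℤ) : ℝ) - ((P : ℝ) - 1) / 2) else 0)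
                + (if a = a₀ then (-((P : ℝ))⁻¹ * ((((toSite y b₀ % (P : ℤ)) : ℤ) : ℝ) - ((P : ℝ) - 1) / 2)) *
                    (if toSite y a₀ % (P : ℤ) = (P : ℤ) - 1 then (1 : ℝ) else 0) else 0)) *
              ∑' s : Site (d + 1), ∑ b' : Fin (d + 1), E2 d Lc 1 (toSite y) s (Sum.inl a) (Sum.inl b') *
                ((if b' = a₀ then (((P : ℝ))⁻¹ * ((P : ℝ))⁻¹) * ((((s b₀ % (P : ℤ)) : ℤ) : ℝ) - ((P : ℝ) - 1) / 2) else 0)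
                  + (if b' = b₀ then (-((P : ℝ))⁻¹ * ((((s a₀ % (P : ℤ)) : ℤ) : ℝ) - ((P : ℝ) - 1) / 2)) *
                      (if s b₀ % (P : ℤ) = (P : ℤ) - 1 then (1 : ℝ) else 0) else 0))))))
            + (((sf * sm)⁻¹ * (sf⁻¹ * sf⁻¹) * cE) * ((sf * sm)⁻¹ * (sf⁻¹ * sf⁻¹) * cE)) *
      ((-(1 / 2 : ℝ)) * (1 / 2 : ℝ) * ((sf * sf) *
        ((wVH d Lc 0)⁻¹ *
            ∑ x ∈ box (d + 1) (Lc * P), ∑ b : Fin (d + 1),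
              ((if b = a₀ then ((((Lc * P : ℕ) : ℝ))⁻¹ * (((Lc * P : ℕ) : ℝ))⁻¹) * ((((toSite x b₀ % ((Lc * P : ℕ) : ℤ) : ℤ) : ℝ) - ((((Lc * P : ℕ) : ℝ)) - 1) / 2)) else 0)
                + (if b = b₀ then (-(((Lc * P : ℕ) : ℝ))⁻¹ * ((((toSite x a₀ % ((Lc * P : ℕ) : ℤ) : ℤ) : ℝ) - ((((Lc * P : ℕ) : ℝ)) - 1) / 2))) *
                    (if toSite x b₀ % ((Lc * P : ℕ) : ℤ) = ((Lc * P : ℕ) : ℤ) - 1 then (1 : ℝ) else 0) else 0)) *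
              ∑' s : Site (d + 1), ∑ b' : Fin (d + 1), E2 d Lc 0 (toSite x) s (Sum.inl b) (Sum.inl b') *
                ((if b' = b₀ then ((((Lc * P : ℕ) : ℝ))⁻¹ * (((Lc * P : ℕ) : ℝ))⁻¹) * ((((s a₀ % ((Lc * P : ℕ) : ℤ) : ℤ) : ℝ) - ((((Lc * P : ℕ) : ℝ)) - 1) / 2)) else 0)
                  + (if b' = a₀ then (-(((Lc * P : ℕ) : ℝ))⁻¹ * ((((s b₀ % ((Lc * P : ℕ) : ℤ) : ℤ) : ℝ) - ((((Lc * P : ℕ) : ℝ)) - 1) / 2))) *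
                      (if s a₀ % ((Lc * P : ℕ) : ℤ) = ((Lc * P : ℕ) : ℤ) - 1 then (1 : ℝ) else 0) else 0)) -
          (wVH d Lc 0)⁻¹ * (((Lc : ℝ) ^ (d + 1) * (Lc : ℝ) ^ (d + 1)) *
            ∑ y ∈ box (d + 1) P, ∑ a : Fin (d + 1),
              ((if a = a₀ then (((P : ℝ))⁻¹ * ((P : ℝ))⁻¹) * ((((toSite y b₀ % (P : ℤ)) : ℤ) : ℝ) - ((P : ℝ) - 1) / 2) else 0)
                + (if a = b₀ then (-((P : ℝ))⁻¹ * ((((toSite y a₀ % (P : ℤ)) : ℤ) : ℝ) - ((P : ℝ) - 1) / 2)) *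
                    (if toSite y b₀ % (P : ℤ) = (P : ℤ) - 1 then (1 : ℝ) else 0) else 0)) *
              ∑' s : Site (d + 1), ∑ b' : Fin (d + 1), E2 d Lc 1 (toSite y) s (Sum.inl a) (Sum.inl b') *
                ((if b' = b₀ then (((P : ℝ))⁻¹ * ((P : ℝ))⁻¹) * ((((s a₀ % (P : ℤ)) : ℤ) : ℝ) - ((P : ℝ) - 1) / 2) else 0)
                  + (if b' = a₀ then (-((P : ℝ))⁻¹ * ((((s b₀ % (P : ℤ)) : ℤ) : ℝ) - ((P : ℝ) - 1) / 2)) *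
                      (if s a₀ % (P : ℤ) = (P : ℤ) - 1 then (1 : ℝ) else 0) else 0))))))) := by
  obtain ⟨C₂, δ₂, hδ₂, hM₂⟩ := exists_locStencilFM_unitM₂_M2Of hLc hr sf sm 0
  exact crossed_faceRead_dressedStep_zero hLc hr hP sf sm cE cVH cΛ (vertexFamily_unitM_M1At hLc hr sf sm cΛ 0) one_pos
    (fun ρ' w t => unitM_M1At_translate (Lc := Lc) (r := r) sf sm cΛ 0 ρ' w t) (fun κ u => trK_unitS_SpureRecAt hLc hr sf sm cE cVH cΛ 0 κ u)
    (fun ρ' w => trK_unitM_M1At (Lc := Lc) (r := r) sf sm cΛ 0 ρ' w) hM₂ hδ₂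
    (fun κ u ρ' w t => unitM₂_M2Of_translate (Lc := Lc) (r := r) sf sm 0 κ u ρ' w t) hBff c cB hab

/-- NOT IN PRINT; OUR BOOKKEEPING.  **(R) AT THE ROOT TABLES** (module docstring): leaf-06 g57's `crossed_faceRead_dressedStep_zero_closedE0` with `M := M̃_0`, `M₂ := M̃₂_0` —
leaf-03's `hface0` left side for road-P2's literal, level-0 Wilson-Hessian pairings evaluated. -/
theorem crossed_faceRead_root_zero_closedE0 (hLc : 1 ≤ Lc) (hr : r ∈ box (d + 1) Lc) {P : ℕ} (hP : 1 ≤ P) (sf sm cE cVH cΛ : ℝ)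
    {B : Tab d} (hBff : ∀ κ u κ' u' x z (α β : Fin (d + 1)), B κ u κ' u' x z (Sum.inl α) (Sum.inl β) = 0) (c cB : ℝ)
    {a₀ b₀ : Fin (d + 1)} (hab : a₀ ≠ b₀) :
        ((fun μ ν α β : Fin (d + 1) => ∑ r' ∈ box (d + 1) P, ∑' u' : Site (d + 1), ∑' x : Site (d + 1), ∑' z : Site (d + 1),
            (if toSite r' μ % (P : ℤ) = (P : ℤ) - 1 ∧ u' ν % (P : ℤ) = (P : ℤ) - 1 ∧ x α % (P : ℤ) = (P : ℤ) - 1 ∧ z β % (P : ℤ) = (P : ℤ) - 1 then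
              (c • mmRead Lc (K3OfK (unitK sf sm (coDressKBmAt (toSite r) Lc (KInvStep (d := d) Lc 0))) Lc (unitS sf sm (SpureRecAt d Lc (toSite r) cE cVH cΛ 0)) (unitM sf sm (M1At d Lc (toSite r) cΛ 0))
                  (W2SymOfK (unitK sf sm (coDressKBmAt (toSite r) Lc (KInvStep (d := d) Lc 0))) Lc (unitS sf sm (SpureRecAt d Lc (toSite r) cE cVH cΛ 0)) (unitM sf sm (M1At d Lc (toSite r) cΛ 0)) 0 (unitM₂ sf sm (M2Of d Lc (mixFFAt (toSite r) Lc) 0))) μ (toSite r') ν u')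
                + cB • B μ (toSite r') ν u') x z (Sum.inl α) (Sum.inl β) else 0)) a₀ b₀ a₀ b₀
          + (fun μ ν α β : Fin (d + 1) => ∑ r' ∈ box (d + 1) P, ∑' u' : Site (d + 1), ∑' x : Site (d + 1), ∑' z : Site (d + 1),
            (if toSite r' μ % (P : ℤ) = (P : ℤ) - 1 ∧ u' ν % (P : ℤ) = (P : ℤ) - 1 ∧ x α % (P : ℤ) = (P : ℤ) - 1 ∧ z β % (P : ℤ) = (P : ℤ) - 1 then
              (c • mmRead Lc (K3OfK (unitK sf sm (coDressKBmAt (toSite r) Lc (KInvStep (d := d) Lc 0))) Lc (unitS sf sm (SpureRecAt d Lc (toSite r) cE cVH cΛ 0)) (unitM sf sm (M1At d Lc (toSite r) cΛ 0))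
                  (W2SymOfK (unitK sf sm (coDressKBmAt (toSite r) Lc (KInvStep (d := d) Lc 0))) Lc (unitS sf sm (SpureRecAt d Lc (toSite r) cE cVH cΛ 0)) (unitM sf sm (M1At d Lc (toSite r) cΛ 0)) 0 (unitM₂ sf sm (M2Of d Lc (mixFFAt (toSite r) Lc) 0))) μ (toSite r') ν u')
                + cB • B μ (toSite r') ν u') x z (Sum.inl α) (Sum.inl β) else 0)) b₀ a₀ a₀ b₀)
        + ((fun μ ν α β : Fin (d + 1) => ∑ r' ∈ box (d + 1) P, ∑' u' : Site (d + 1), ∑' x : Site (d + 1), ∑' z : Site (d + 1),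
            (if toSite r' μ % (P : ℤ) = (P : ℤ) - 1 ∧ u' ν % (P : ℤ) = (P : ℤ) - 1 ∧ x α % (P : ℤ) = (P : ℤ) - 1 ∧ z β % (P : ℤ) = (P : ℤ) - 1 then
              (c • mmRead Lc (K3OfK (unitK sf sm (coDressKBmAt (toSite r) Lc (KInvStep (d := d) Lc 0))) Lc (unitS sf sm (SpureRecAt d Lc (toSite r) cE cVH cΛ 0)) (unitM sf sm (M1At d Lc (toSite r) cΛ 0))
                  (W2SymOfK (unitK sf sm (coDressKBmAt (toSite r) Lc (KInvStep (d := d) Lc 0))) Lc (unitS sf sm (SpureRecAt d Lc (toSite r) cE cVH cΛ 0)) (unitM sf sm (M1At d Lc (toSite r) cΛ 0)) 0 (unitM₂ sf sm (M2Of d Lc (mixFFAt (toSite r) Lc) 0))) μ (toSite r') ν u')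
                + cB • B μ (toSite r') ν u') x z (Sum.inl α) (Sum.inl β) else 0)) b₀ a₀ a₀ b₀
          + (fun μ ν α β : Fin (d + 1) => ∑ r' ∈ box (d + 1) P, ∑' u' : Site (d + 1), ∑' x : Site (d + 1), ∑' z : Site (d + 1),
            (if toSite r' μ % (P : ℤ) = (P : ℤ) - 1 ∧ u' ν % (P : ℤ) = (P : ℤ) - 1 ∧ x α % (P : ℤ) = (P : ℤ) - 1 ∧ z β % (P : ℤ) = (P : ℤ) - 1 then
              (c • mmRead Lc (K3OfK (unitK sf sm (coDressKBmAt (toSite r) Lc (KInvStep (d := d) Lc 0))) Lc (unitS sf sm (SpureRecAt d Lc (toSite r) cE cVH cΛ 0)) (unitM sf sm (M1At d Lc (toSite r) cΛ 0))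
                  (W2SymOfK (unitK sf sm (coDressKBmAt (toSite r) Lc (KInvStep (d := d) Lc 0))) Lc (unitS sf sm (SpureRecAt d Lc (toSite r) cE cVH cΛ 0)) (unitM sf sm (M1At d Lc (toSite r) cΛ 0)) 0 (unitM₂ sf sm (M2Of d Lc (mixFFAt (toSite r) Lc) 0))) μ (toSite r') ν u')
                + cB • B μ (toSite r') ν u') x z (Sum.inl α) (Sum.inl β) else 0)) a₀ b₀ a₀ b₀)
        + (((fun μ ν α β : Fin (d + 1) => ∑ r' ∈ box (d + 1) P, ∑' u' : Site (d + 1), ∑' x : Site (d + 1), ∑' z : Site (d + 1),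
            (if toSite r' μ % (P : ℤ) = (P : ℤ) - 1 ∧ u' ν % (P : ℤ) = (P : ℤ) - 1 ∧ x α % (P : ℤ) = (P : ℤ) - 1 ∧ z β % (P : ℤ) = (P : ℤ) - 1 then
              (c • mmRead Lc (K3OfK (unitK sf sm (coDressKBmAt (toSite r) Lc (KInvStep (d := d) Lc 0))) Lc (unitS sf sm (SpureRecAt d Lc (toSite r) cE cVH cΛ 0)) (unitM sf sm (M1At d Lc (toSite r) cΛ 0))
                  (W2SymOfK (unitK sf sm (coDressKBmAt (toSite r) Lc (KInvStep (d := d) Lc 0))) Lc (unitS sf sm (SpureRecAt d Lc (toSite r) cE cVH cΛ 0)) (unitM sf sm (M1At d Lc (toSite r) cΛ 0)) 0 (unitM₂ sf sm (M2Of d Lc (mixFFAt (toSite r) Lc) 0))) μ (toSite r') ν u')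
                + cB • B μ (toSite r') ν u') x z (Sum.inl α) (Sum.inl β) else 0)) a₀ b₀ b₀ a₀
          + (fun μ ν α β : Fin (d + 1) => ∑ r' ∈ box (d + 1) P, ∑' u' : Site (d + 1), ∑' x : Site (d + 1), ∑' z : Site (d + 1),
            (if toSite r' μ % (P : ℤ) = (P : ℤ) - 1 ∧ u' ν % (P : ℤ) = (P : ℤ) - 1 ∧ x α % (P : ℤ) = (P : ℤ) - 1 ∧ z β % (P : ℤ) = (P : ℤ) - 1 then
              (c • mmRead Lc (K3OfK (unitK sf sm (coDressKBmAt (toSite r) Lc (KInvStep (d := d) Lc 0))) Lc (unitS sf sm (SpureRecAt d Lc (toSite r) cE cVH cΛ 0)) (unitM sf sm (M1At d Lc (toSite r) cΛ 0))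
                  (W2SymOfK (unitK sf sm (coDressKBmAt (toSite r) Lc (KInvStep (d := d) Lc 0))) Lc (unitS sf sm (SpureRecAt d Lc (toSite r) cE cVH cΛ 0)) (unitM sf sm (M1At d Lc (toSite r) cΛ 0)) 0 (unitM₂ sf sm (M2Of d Lc (mixFFAt (toSite r) Lc) 0))) μ (toSite r') ν u')
                + cB • B μ (toSite r') ν u') x z (Sum.inl α) (Sum.inl β) else 0)) b₀ a₀ b₀ a₀)
        + ((fun μ ν α β : Fin (d + 1) => ∑ r' ∈ box (d + 1) P, ∑' u' : Site (d + 1), ∑' x : Site (d + 1), ∑' z : Site (d + 1),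
            (if toSite r' μ % (P : ℤ) = (P : ℤ) - 1 ∧ u' ν % (P : ℤ) = (P : ℤ) - 1 ∧ x α % (P : ℤ) = (P : ℤ) - 1 ∧ z β % (P : ℤ) = (P : ℤ) - 1 then
              (c • mmRead Lc (K3OfK (unitK sf sm (coDressKBmAt (toSite r) Lc (KInvStep (d := d) Lc 0))) Lc (unitS sf sm (SpureRecAt d Lc (toSite r) cE cVH cΛ 0)) (unitM sf sm (M1At d Lc (toSite r) cΛ 0))
                  (W2SymOfK (unitK sf sm (coDressKBmAt (toSite r) Lc (KInvStep (d := d) Lc 0))) Lc (unitS sf sm (SpureRecAt d Lc (toSite r) cE cVH cΛ 0)) (unitM sf sm (M1At d Lc (toSite r) cΛ 0)) 0 (unitM₂ sf sm (M2Of d Lc (mixFFAt (toSite r) Lc) 0))) μ (toSite r') ν u')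
                + cB • B μ (toSite r') ν u') x z (Sum.inl α) (Sum.inl β) else 0)) b₀ a₀ b₀ a₀
          + (fun μ ν α β : Fin (d + 1) => ∑ r' ∈ box (d + 1) P, ∑' u' : Site (d + 1), ∑' x : Site (d + 1), ∑' z : Site (d + 1),
            (if toSite r' μ % (P : ℤ) = (P : ℤ) - 1 ∧ u' ν % (P : ℤ) = (P : ℤ) - 1 ∧ x α % (P : ℤ) = (P : ℤ) - 1 ∧ z β % (P : ℤ) = (P : ℤ) - 1 then
              (c • mmRead Lc (K3OfK (unitK sf sm (coDressKBmAt (toSite r) Lc (KInvStep (d := d) Lc 0))) Lc (unitS sf sm (SpureRecAt d Lc (toSite r) cE cVH cΛ 0)) (unitM sf sm (M1At d Lc (toSite r) cΛ 0))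
                  (W2SymOfK (unitK sf sm (coDressKBmAt (toSite r) Lc (KInvStep (d := d) Lc 0))) Lc (unitS sf sm (SpureRecAt d Lc (toSite r) cE cVH cΛ 0)) (unitM sf sm (M1At d Lc (toSite r) cΛ 0)) 0 (unitM₂ sf sm (M2Of d Lc (mixFFAt (toSite r) Lc) 0))) μ (toSite r') ν u')
                + cB • B μ (toSite r') ν u') x z (Sum.inl α) (Sum.inl β) else 0)) a₀ b₀ b₀ a₀))
          = 4 * ((c * -(((sf * sm) * (stepScale d Lc 0 * (Lc : ℝ) ^ (d + 1))⁻¹) * ((sf * sm) * (stepScale d Lc 0 * (Lc : ℝ) ^ (d + 1))⁻¹))) * (((sf * sm) * (stepScale d Lc 0 * (Lc : ℝ) ^ (d + 1))⁻¹) * ((sf * sm) * (stepScale d Lc 0 * (Lc : ℝ) ^ (d + 1))⁻¹))) *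
            ((((sf * sm)⁻¹ * (sf⁻¹ * sf⁻¹) * cE) * ((sf * sm)⁻¹ * (sf⁻¹ * sf⁻¹) * cE)) *
      ((-(1 / 2 : ℝ)) * (1 / 2 : ℝ) * ((sf * sf) *
        ((wVH d Lc 0)⁻¹ *
            (2 * ((0 : ℝ) - 1) * ((((Lc * P : ℕ) : ℝ)) ^ (d - 1) * (1 - (((Lc * P : ℕ) : ℝ))⁻¹ * (((Lc * P : ℕ) : ℝ))⁻¹))) -
          (wVH d Lc 0)⁻¹ * (((Lc : ℝ) ^ (d + 1) * (Lc : ℝ) ^ (d + 1)) *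
            ∑ y ∈ box (d + 1) P, ∑ a : Fin (d + 1),
              ((if a = b₀ then (((P : ℝ))⁻¹ * ((P : ℝ))⁻¹) * ((((toSite y a₀ % (P : ℤ)) : ℤ) : ℝ) - ((P : ℝ) - 1) / 2) else 0)
                + (if a = a₀ then (-((P : ℝ))⁻¹ * ((((toSite y b₀ % (P : ℤ)) : ℤ) : ℝ) - ((P : ℝ) - 1) / 2)) *
                    (if toSite y a₀ % (P : ℤ) = (P : ℤ) - 1 then (1 : ℝ) else 0) else 0)) *
              ∑' s : Site (d + 1), ∑ b' : Fin (d + 1), E2 d Lc 1 (toSite y) s (Sum.inl a) (Sum.inl b') *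
                ((if b' = a₀ then (((P : ℝ))⁻¹ * ((P : ℝ))⁻¹) * ((((s b₀ % (P : ℤ)) : ℤ) : ℝ) - ((P : ℝ) - 1) / 2) else 0)
                  + (if b' = b₀ then (-((P : ℝ))⁻¹ * ((((s a₀ % (P : ℤ)) : ℤ) : ℝ) - ((P : ℝ) - 1) / 2)) *
                      (if s b₀ % (P : ℤ) = (P : ℤ) - 1 then (1 : ℝ) else 0) else 0))))))
            + (((sf * sm)⁻¹ * (sf⁻¹ * sf⁻¹) * cE) * ((sf * sm)⁻¹ * (sf⁻¹ * sf⁻¹) * cE)) *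
      ((-(1 / 2 : ℝ)) * (1 / 2 : ℝ) * ((sf * sf) *
        ((wVH d Lc 0)⁻¹ *
            (2 * ((0 : ℝ) - 1) * ((((Lc * P : ℕ) : ℝ)) ^ (d - 1) * (1 - (((Lc * P : ℕ) : ℝ))⁻¹ * (((Lc * P : ℕ) : ℝ))⁻¹))) -
          (wVH d Lc 0)⁻¹ * (((Lc : ℝ) ^ (d + 1) * (Lc : ℝ) ^ (d + 1)) *
            ∑ y ∈ box (d + 1) P, ∑ a : Fin (d + 1),
              ((if a = a₀ then (((P : ℝ))⁻¹ * ((P : ℝ))⁻¹) * ((((toSite y b₀ % (P : ℤ)) : ℤ) : ℝ) - ((P : ℝ) - 1) / 2) else 0)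
                + (if a = b₀ then (-((P : ℝ))⁻¹ * ((((toSite y a₀ % (P : ℤ)) : ℤ) : ℝ) - ((P : ℝ) - 1) / 2)) *
                    (if toSite y b₀ % (P : ℤ) = (P : ℤ) - 1 then (1 : ℝ) else 0) else 0)) *
              ∑' s : Site (d + 1), ∑ b' : Fin (d + 1), E2 d Lc 1 (toSite y) s (Sum.inl a) (Sum.inl b') *
                ((if b' = b₀ then (((P : ℝ))⁻¹ * ((P : ℝ))⁻¹) * ((((s a₀ % (P : ℤ)) : ℤ) : ℝ) - ((P : ℝ) - 1) / 2) else 0)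
                  + (if b' = a₀ then (-((P : ℝ))⁻¹ * ((((s b₀ % (P : ℤ)) : ℤ) : ℝ) - ((P : ℝ) - 1) / 2)) *
                      (if s a₀ % (P : ℤ) = (P : ℤ) - 1 then (1 : ℝ) else 0) else 0))))))) := by
  obtain ⟨C₂, δ₂, hδ₂, hM₂⟩ := exists_locStencilFM_unitM₂_M2Of hLc hr sf sm 0
  exact crossed_faceRead_dressedStep_zero_closedE0 hLc hr hP sf sm cE cVH cΛ (vertexFamily_unitM_M1At hLc hr sf sm cΛ 0) one_pos
    (fun ρ' w t => unitM_M1At_translate (Lc := Lc) (r := r) sf sm cΛ 0 ρ' w t) (fun κ u => trK_unitS_SpureRecAt hLc hr sf sm cE cVH cΛ 0 κ u)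
    (fun ρ' w => trK_unitM_M1At (Lc := Lc) (r := r) sf sm cΛ 0 ρ' w) hM₂ hδ₂
    (fun κ u ρ' w t => unitM₂_M2Of_translate (Lc := Lc) (r := r) sf sm 0 κ u ρ' w t) hBff c cB hab

end Summit.QuantumFields.BalabanUV.Beta.GAN24.FaceReadCrossedValueRoot

end
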